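import Summits.QuantumAdvantage.QuantumAdvantage.Theorems.CharDialBlockDialA
import HarnessLib

/-!
# The block dial, part B: the piece game is a generalised-bell game — `blockPiece_hard` (decomp-qadv lens-6 g17 «OrbitDial», tree part 30N)

Along a block piece every block-constant linear form mod `p` is FROZEN (`form_bset`: `p·λ = 0`) while the walk moves by `p ≢ 0 (mod 3)` per block
(`live_iff`, the unit `rfac p` inverts `p` mod 3); each cut becomes two straddle-conditioned generalised bells whose tables have 𝔽₂-degree
`≤ L + 1` in the block bits (`hasDeg_bell`, juntas meet `≤ L` blocks), and re-indexing (`bellEquiv`, `ringWinU_bset`) makes the piece game LITERALLY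
`AffBells23.ringWinGen`; `AffBells23.walkHardGenSqrt` then gives ★ `blockPiece_hard`: at most `θ·2^N` of the `2^N` piece points win once `N ≥ N₀`, `(L+1)² ≤ N`.
Supports item stmt-QuantumAdvantage-32604 (`CharDial.WalkHardFJLinOdd`); source: pub annex g17/OrbitDial37.lean §37q REV12 (sha256 7a2cb935…), namespace `…Theses.OrbitDial.BlockDial`, statements and proofs verbatim with the Prop abbreviations `InBlk`/`IsConst`/`BlkSep` INLINED (Prop-free twin).
-/

set_option autoImplicit false

namespace Summit.QuantumAdvantage.AdviceFreeQNC0.JLinPeel.BlockDial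

open Finset
open Summit.QuantumAdvantage.AdviceFreeQNC0
open Literature.Computability.MetaComplexity Literature.Computability.MetaComplexity.Smolensky

section BlockPiece
variable {n N : ℕ}
variable {p : ℕ} {s : Fin N → ℕ}

/-! #### mod-3 bookkeeping: the block walk is `p ×` the standard walk, and `p ≢ 0 (mod 3)` -/

/-- `p ≡ 1 (mod 3)`: the factor `p` disappears mod 3. -/
theorem mod3_of_one {p x y : ℕ} (hp : p % 3 = 1) : ((x + p * y) % 3 ≠ 0 ↔ (x + y) % 3 ≠ 0) := by
  obtain ⟨t, rfl⟩ : ∃ t, p = 3 * t + 1 := ⟨p / 3, by omega⟩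
  have e : (3 * t + 1) * y = 3 * (t * y) + y := by ring
  rw [e]
  generalize t * y = w
  omega

/-- `p ≡ 2 (mod 3)`: the factor `p` is absorbed by doubling the phase. -/
theorem mod3_of_two {p x y : ℕ} (hp : p % 3 = 2) : ((x + p * y) % 3 ≠ 0 ↔ (2 * x + y) % 3 ≠ 0) := by
  obtain ⟨t, rfl⟩ : ∃ t, p = 3 * t + 2 := ⟨p / 3, by omega⟩
  have e : (3 * t + 2) * y = 3 * (t * y) + 2 * y := by ring
  rw [e]
  generalize t * y = w
  omega

/-- phase factor: `1` if `p ≡ 1`, `2` if `p ≡ 2 (mod 3)`. -/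
def rfac (p : ℕ) : ℕ := if p % 3 = 1 then 1 else 2

/-- the PHASE of the bell `(g, ε)` of the piece game (`ε` = the straddle bit the bell is conditioned on). -/
def kap (p : ℕ) (s : Fin N → ℕ) (c : ℕ) (u : Fin n → Bool) (g : ℕ) (ε : Bool) : ℕ :=
  rfac p * (c + g + offW p s u + offP p s u g + (if ε = true then mstr (n := n) p s g else 0))

/-- **liveness on a block piece is liveness of a standard bell in block coordinates** (pattern position `qcut g`,
phase `kap … (sel g v)`). -/
theorem live_iff (h : ((∀ k k', k < k' → s k + p ≤ s k') ∧ (∀ k, s k + p ≤ n))) (hp3 : p % 3 = 1 ∨ p % 3 = 2) (c : ℕ) (u : Fin n → Bool) (v : Fin N → Bool) (g : ℕ) :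
    ((c + g + walkExp (bset p s u v) g) % 3 ≠ 0)
      ↔ ((kap p s c u g (sel p s g v) + walkExp v (qcut p s g)) % 3 ≠ 0) := by
  rw [walkExp_bset h]
  have e : c + g + (offW p s u + offP p s u g + p * walkExp v (qcut p s g)
      + (if sel p s g v = true then mstr (n := n) p s g else 0))
      = (c + g + offW p s u + offP p s u g + (if sel p s g v = true then mstr (n := n) p s g else 0))
        + p * walkExp v (qcut p s g) := by ring
  rw [e]
  rcases hp3 with h1 | h2
  · rw [mod3_of_one h1, kap, rfac, if_pos h1, one_mul]
  · have hne : ¬ p % 3 = 1 := by omega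
    rw [mod3_of_two h2, kap, rfac, if_neg hne]

/-! #### forms are constant along a block piece -/

/-- a block-constant coefficient vector sums to `0` over every block piece's block (`p · λ = 0` in `ℤ/p`). -/
theorem sum_blk_bset_eq_zero (h : ((∀ k k', k < k' → s k + p ≤ s k') ∧ (∀ k, s k + p ≤ n))) (a : Fin n → ZMod p) {k : Fin N}
    (hconst : ∀ i i' : Fin n, (s k ≤ i.val ∧ i.val < s k + p) → (s k ≤ i'.val ∧ i'.val < s k + p) → a i = a i') (u : Fin n → Bool) (w : Fin N → Bool) :
    (∑ i ∈ blk p s k, (if bset p s u w i = true then a i else 0)) = 0 := by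
  rcases (blk (n := n) p s k).eq_empty_or_nonempty with he | ⟨i₀, hi₀⟩
  · rw [he, Finset.sum_empty]
  · rw [Finset.sum_congr rfl fun i hi => by
      rw [bset_of_inBlk h u w (mem_blk.mp hi), hconst i i₀ (mem_blk.mp hi) (mem_blk.mp hi₀)],
      Finset.sum_const, card_blk h k]
    cases w k
    · simp
    · simp [nsmul_eq_mul]

/-- **the form of a block-constant cut is CONSTANT along a block piece.** -/
theorem form_bset (h : ((∀ k k', k < k' → s k + p ≤ s k') ∧ (∀ k, s k + p ≤ n))) (D : JLinPeel.JLinData p n) (g : Fin (n + 1))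
    (hconst : ∀ (k : Fin N) (i i' : Fin n), (s k ≤ i.val ∧ i.val < s k + p) → (s k ≤ i'.val ∧ i'.val < s k + p) → D.a g i = D.a g i')
    (u : Fin n → Bool) (v v' : Fin N → Bool) :
    D.form g (bset p s u v) = D.form g (bset p s u v') := by
  unfold JLinPeel.JLinData.form
  have split := fun w : Fin N → Bool => sum_split h (fun i => if bset p s u w i = true then D.a g i else 0)
  rw [split v, split v']
  congr 1
  · refine Finset.sum_congr rfl fun i hi => ?_
    rw [bset_of_not_inBlk u v (not_inBlk_of_mem_sdiff hi), bset_of_not_inBlk u v' (not_inBlk_of_mem_sdiff hi)]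
  · refine Finset.sum_congr rfl fun k _ => ?_
    rw [sum_blk_bset_eq_zero h (D.a g) (hconst k) u v, sum_blk_bset_eq_zero h (D.a g) (hconst k) u v']

/-- along a block piece a cut's answer depends on `v` only through the blocks meeting its junta (the form is constant). -/
theorem strat_bset_eq (h : ((∀ k k', k < k' → s k + p ≤ s k') ∧ (∀ k, s k + p ≤ n))) (D : JLinPeel.JLinData p n) (g : Fin (n + 1))
    (hconst : ∀ (k : Fin N) (i i' : Fin n), (s k ≤ i.val ∧ i.val < s k + p) → (s k ≤ i'.val ∧ i'.val < s k + p) → D.a g i = D.a g i')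
    (u : Fin n → Bool) {v v' : Fin N → Bool}
    (hvv : ∀ k : Fin N, (∃ i ∈ D.J g, (s k ≤ i.val ∧ i.val < s k + p)) → v k = v' k) :
    D.strat g (bset p s u v) = D.strat g (bset p s u v') := by
  have hJ : ∀ i ∈ D.J g, bset p s u v i = bset p s u v' i := by
    intro i hi
    by_cases hk : ∃ k, (s k ≤ i.val ∧ i.val < s k + p)
    · obtain ⟨k, hk⟩ := hk
      rw [bset_of_inBlk h u v hk, bset_of_inBlk h u v' hk, hvv k ⟨i, hi, hk⟩]
    · rw [not_exists] at hk
      rw [bset_of_not_inBlk u v hk, bset_of_not_inBlk u v' hk]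
  show D.h g (bset p s u v) (D.form g (bset p s u v)) = D.h g (bset p s u v') (D.form g (bset p s u v'))
  rw [form_bset h D g hconst u v v', D.hJ g _ _ hJ]

/-- the number of blocks meeting a junta is at most the junta's size (a coordinate lies in ≤ 1 block). -/
theorem card_blkMeet_le (h : ((∀ k k', k < k' → s k + p ≤ s k') ∧ (∀ k, s k + p ≤ n))) (J : Finset (Fin n)) :
    (univ.filter fun k : Fin N => ∃ i ∈ J, (s k ≤ i.val ∧ i.val < s k + p)).card ≤ J.card := by
  classical
  rcases J.eq_empty_or_nonempty with he | ⟨i₀, hi₀⟩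
  · simp [he]
  · let f : Fin N → Fin n := fun k => if hk : ∃ i ∈ J, (s k ≤ i.val ∧ i.val < s k + p) then hk.choose else i₀
    refine Finset.card_le_card_of_injOn f (fun k hk => ?_) (fun k hk k' hk' hff => ?_)
    · rw [Finset.mem_coe, mem_filter] at hk
      show (if hk : ∃ i ∈ J, (s k ≤ i.val ∧ i.val < s k + p) then hk.choose else i₀) ∈ J
      rw [dif_pos hk.2]
      exact hk.2.choose_spec.1
    · rw [Finset.mem_coe, mem_filter] at hk hk'
      have e1 : f k = hk.2.choose := dif_pos hk.2
      have e2 : f k' = hk'.2.choose := dif_pos hk'.2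
      have h1 : (s k ≤ hk.2.choose.val ∧ hk.2.choose.val < s k + p) := hk.2.choose_spec.2
      have h2 : (s k' ≤ hk'.2.choose.val ∧ hk'.2.choose.val < s k' + p) := hk'.2.choose_spec.2
      rw [← e1] at h1
      rw [← e2, ← hff] at h2
      exact inBlk_unique h h1 h2

/-- copy of the annex's `hasDeg_of_dependsOn'` (dependence on `≤ d` coordinates ⇒ degree `≤ d`). -/
theorem hasDeg_of_dependsOn_blk {m d : ℕ} {f : (Fin m → Bool) → Bool} (K : Finset (Fin m)) (hK : K.card ≤ d)
    (hf : ∀ u v : Fin m → Bool, (∀ i ∈ K, u i = v i) → f u = f v) : HasDeg f d := by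
  unfold HasDeg; exact lowDeg_mono hK (ind_mem_lowDeg_of_dependsOn (F := ZMod 2) K f hf)

/-- the straddle bit depends only on the straddling block's coordinate. -/
theorem sel_congr (g : ℕ) {v v' : Fin N → Bool} (hvv : ∀ k ∈ strad p s g, v k = v' k) :
    sel p s g v = sel p s g v' := by
  unfold sel
  rw [decide_eq_decide]
  constructor
  · rintro ⟨k, hk, hv⟩; exact ⟨k, hk, by rw [← hvv k hk]; exact hv⟩
  · rintro ⟨k, hk, hv⟩; exact ⟨k, hk, by rw [hvv k hk]; exact hv⟩

/-- **degree of a piece-game bell**: junta `≤ L` ⇒ the bell `(g, ε)` has degree `≤ L + 1` in the block bits. -/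
theorem hasDeg_bell (h : ((∀ k k', k < k' → s k + p ≤ s k') ∧ (∀ k, s k + p ≤ n))) (D : JLinPeel.JLinData p n) (g : Fin (n + 1)) (ε : Bool) {L d : ℕ}
    (hJ : (D.J g).card ≤ L) (hd : L + 1 ≤ d)
    (hconst : ∀ (k : Fin N) (i i' : Fin n), (s k ≤ i.val ∧ i.val < s k + p) → (s k ≤ i'.val ∧ i'.val < s k + p) → D.a g i = D.a g i')
    (u : Fin n → Bool) :
    HasDeg (fun v : Fin N → Bool => D.strat g (bset p s u v) && (ε == sel p s g.val v)) d := by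
  classical
  refine hasDeg_of_dependsOn_blk ((univ.filter fun k : Fin N => ∃ i ∈ D.J g, (s k ≤ i.val ∧ i.val < s k + p)) ∪ strad p s g.val) ?_
    fun v v' hvv => ?_
  · calc ((univ.filter fun k : Fin N => ∃ i ∈ D.J g, (s k ≤ i.val ∧ i.val < s k + p)) ∪ strad p s g.val).card
        ≤ (univ.filter fun k : Fin N => ∃ i ∈ D.J g, (s k ≤ i.val ∧ i.val < s k + p)).card + (strad p s g.val).card := Finset.card_union_le _ _
      _ ≤ L + 1 := add_le_add (le_trans (card_blkMeet_le h (D.J g)) hJ) (card_strad_le_one h g.val)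
      _ ≤ d := hd
  · have h1 : D.strat g (bset p s u v) = D.strat g (bset p s u v') :=
      strat_bset_eq h D g hconst u fun k hk => hvv k (Finset.mem_union_left _ (mem_filter.mpr ⟨mem_univ _, hk⟩))
    have h2 : sel p s g.val v = sel p s g.val v' := sel_congr g.val fun k hk => hvv k (Finset.mem_union_right _ hk)
    rw [h1, h2]

/-! #### the piece game IS a generalised-bell walk game in block coordinates -/

/-- bell decoding `Fin ((n+1)·2) ≃ Fin (n+1) × Bool`: bell `(g, ε)` = cut `g` conditioned on straddle bit `ε`. -/
def bellEquiv (n : ℕ) : Fin ((n + 1) * 2) ≃ Fin (n + 1) × Bool :=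
  finProdFinEquiv.symm.trans (Equiv.prodCongr (Equiv.refl _) finTwoEquiv)

/-- **the game identity**: the walk game at the piece point `bset u v` is the generalised-bell game played on `v`, with two
conditioned bells per cut (pattern position `qcut g`, phases `kap … ff / tt`). -/
theorem ringWinU_bset (h : ((∀ k k', k < k' → s k + p ≤ s k') ∧ (∀ k, s k + p ≤ n))) (hp3 : p % 3 = 1 ∨ p % 3 = 2) (c : ℕ) (D : JLinPeel.JLinData p n)
    (u : Fin n → Bool) (v : Fin N → Bool) :
    ringWinU c D.strat (bset p s u v)
      = AffBells23.ringWinGen (fun b => qcut p s (bellEquiv n b).1.val) (fun b => kap p s c u (bellEquiv n b).1.val (bellEquiv n b).2)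
          (fun b w => D.strat (bellEquiv n b).1 (bset p s u w) && ((bellEquiv n b).2 == sel p s (bellEquiv n b).1.val w)) v := by
  unfold ringWinU AffBells23.ringWinGen
  congr 3
  symm
  -- count over `Fin ((n+1)·2)` = count over `Fin (n+1) × Bool`
  rw [Finset.card_equiv (bellEquiv n) (t := univ.filter fun x : Fin (n + 1) × Bool =>
      (D.strat x.1 (bset p s u v) && (x.2 == sel p s x.1.val v)) = true
        ∧ (kap p s c u x.1.val x.2 + walkExp v (qcut p s x.1.val)) % 3 ≠ 0) (fun b => by simp)]
  -- exactly the bell with `ε = sel g v` can fire, and its liveness is the cut's liveness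
  symm
  refine Finset.card_bij (fun (g : Fin (n + 1)) _ => (g, sel p s g.val v)) (fun g hg => ?_) (fun g₁ _ g₂ _ hh => ?_) (fun x hx => ?_)
  · rw [mem_filter] at hg ⊢
    refine ⟨mem_univ _, by simpa using hg.2.1, ?_⟩
    exact (live_iff h hp3 c u v g.val).mp hg.2.2
  · exact (Prod.ext_iff.mp hh).1
  · rw [mem_filter] at hx
    obtain ⟨_, h1, h2⟩ := hx
    rw [Bool.and_eq_true] at h1
    have hε : x.2 = sel p s x.1.val v := by simpa using h1.2
    refine ⟨x.1, ?_, ?_⟩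
    · rw [mem_filter]
      refine ⟨mem_univ _, h1.1, ?_⟩
      rw [hε] at h2
      exact (live_iff h hp3 c u v x.1.val).mpr h2
    · ext <;> simp [hε]

/-- ★ **THE BLOCK-PIECE ENGINE** (the local half of a W-aware dial): along EVERY block piece — `N` separated `p`-blocks on which
every cut's coefficient vector is constant, made constant-and-free — a junta-`≤ L` ⊕ linear-form strategy wins on at most
`θ·2^N` of the `2^N` piece points, as soon as `N ≥ N₀` and `(L+1)² ≤ N`.  No rank hypothesis, no sparsity hypothesis, no
primality: only `p ≢ 0 (mod 3)`.  Every block-constant form — the all-ones form `W`, class indicators of interval classes,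
`W +` anything block-constant — is FROZEN along the piece while the walk moves by `±p ≢ 0 (mod 3)` per block; the piece game is
the tree's generalised-bell game (`walkHardGenSqrt`) with two straddle-conditioned bells per cut. -/
theorem blockPiece_hard (p : ℕ) (hp3 : p % 3 = 1 ∨ p % 3 = 2) :
    ∃ θ : ℝ, θ < 1 ∧ ∃ N₀ : ℕ, ∀ (n N : ℕ) (s : Fin N → ℕ), ((∀ k k', k < k' → s k + p ≤ s k') ∧ (∀ k, s k + p ≤ n)) → N₀ ≤ N →
      ∀ (L : ℕ), (L + 1) * (L + 1) ≤ N → ∀ (c : ℕ) (D : JLinPeel.JLinData p n),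
        (∀ g, (D.J g).card ≤ L) →
        (∀ g (k : Fin N) (i i' : Fin n), (s k ≤ i.val ∧ i.val < s k + p) → (s k ≤ i'.val ∧ i'.val < s k + p) → D.a g i = D.a g i') →
        ∀ u : Fin n → Bool,
          ((univ.filter fun v : Fin N → Bool => ringWinU c D.strat (bset p s u v) = true).card : ℝ) ≤ θ * (2 : ℝ) ^ N := by
  obtain ⟨θ, hθ, n₀, hgen⟩ := AffBells23.walkHardGenSqrt
  refine ⟨θ, hθ, n₀, fun n N s hs hN L hL c D hJ hconst u => ?_⟩
  have hdeg : ∀ b : Fin ((n + 1) * 2), HasDeg (fun w : Fin N → Bool =>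
      D.strat (bellEquiv n b).1 (bset p s u w) && ((bellEquiv n b).2 == sel p s (bellEquiv n b).1.val w)) (Nat.sqrt N) :=
    fun b => hasDeg_bell hs D _ _ (hJ _) (Nat.le_sqrt.mpr hL) (hconst _) u
  have hb := hgen N hN ((n + 1) * 2) (fun b => qcut p s (bellEquiv n b).1.val)
    (fun b => kap p s c u (bellEquiv n b).1.val (bellEquiv n b).2) _ hdeg
  have hset : (univ.filter fun v : Fin N → Bool => ringWinU c D.strat (bset p s u v) = true)
      = univ.filter fun v : Fin N → Bool => AffBells23.ringWinGen (fun b => qcut p s (bellEquiv n b).1.val)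
          (fun b => kap p s c u (bellEquiv n b).1.val (bellEquiv n b).2)
          (fun b w => D.strat (bellEquiv n b).1 (bset p s u w) && ((bellEquiv n b).2 == sel p s (bellEquiv n b).1.val w)) v
          = true := by
    refine Finset.filter_congr fun v _ => ?_
    rw [ringWinU_bset hs hp3 c D u v]
  rw [hset]
  exact hb



end BlockPiece

end Summit.QuantumAdvantage.AdviceFreeQNC0.JLinPeel.BlockDial
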